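import Summits.CriticalPhenomena.PercolationContinuityZ3.Theorems.PercNearOneGluingNoHeavyLowerTailCSHDefs
import Summits.CriticalPhenomena.PercolationContinuityZ3.Theorems.Transplant.SiteAGlocOfGen
import HarnessLib

/-!
# SITE percolation: the conditioned slack hierarchy CSH and the (S5D) margins — DEFINITIONS
# (lane `prim-bschramm`, class C1a; site twin of `Theorems/PercNearOneGluingNoHeavyLowerTailCSHDefs.lean`)

builds on p205010 (kernel theorem, internal audit signed; external expert review pending).

The site finite leg is kernel-checked from (S5)_site upward (`SiteGen.siteAdditiveGluing_of_siteSurplusTransfer`,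
p209354).  Below (S5) the bond chain runs CSH (Theorem 1) ⟹ (S5D) (peeling, Theorem 2) ⟹ (S5).  This file fixes
the SITE DEFINITIONS of that leg so that the peeling and the CSH induction can be re-typed against them:

* the level-form algebra `CSH.slForm`, `CSH.cshMarg` (Lemma R etc.) is MODEL-FREE and is reused from the bond file;
* `SiteCSH.avoidConst`, `decoyList`, `obsConst` — the decoy / observers' constants for SITE events
  (`{d ↮ A} = {∀ a ∈ A, a ∉ C_d}`, `{d ↔ u} = siteConn Γ d u`);
* `SiteCSH.covD` — the denominator-free conditional covariance of a functional of the SITE cluster `C_x = siteCluster Γ ω x`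
  against `1{x ↔ u}` given `{x ↮ Y}`;
* `SiteCSH.cshMargin`, **`SiteCSH.SiteCSHHolds`** — the site CSH statement (monotone functionals of the site cluster);
* `SiteCSH.surplus` (= the bracket of `SiteGen.SiteSurplusTransfer`, `surplus_eq`), `SiteCSH.s5dMargin`, `s5dMargin_nil`,
  and the socket `siteSurplusTransfer_shape_of_s5dMargin_nil` ((S5)_site in the `SiteSurplusTransfer` shape from the
  decoy-free margin when `P(v ↮ T) > 0`).

Definitions file (`--supports stmt-CriticalPhenomena-4575 --as helper`); no theorems beyond unfoldings; sorry-free.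
[cite: KozmaNitzan2024, Conj. 4 (p. 32)] [cite: VandenbergHaggstromKahn2005, §2.1 (pp. 9–13)]
-/

noncomputable section

namespace Summit.CriticalPhenomena.PercolationContinuityZ3.Theorems.Transplant

namespace SiteCSH

open MeasureTheory Set Literature.Probability.LatticeModels Literature.Probability.Percolation
open Summit.CriticalPhenomena.PercolationContinuityZ3.Theorems.CSH (slForm cshMarg cshMarg_nil)
open Summit.CriticalPhenomena.PercolationContinuityZ3.Theorems.SiteTransplant (siteConn)
open scoped Classical

variable {V : Type*} (Γ : SimpleGraph V)

/-! ### The site percolation data of the hierarchy -/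

/-- The site decoy constant `c(u) = P(d ↮ A, d ↔ u) / P(d ↮ A)`, `{d ↮ A} = {∀ a ∈ A, a ∉ C_d}` (site clusters; `A` = owner ∪
avoided set ∪ earlier decoys).  Site twin of `CSH.avoidConst`. [cite: KozmaNitzan2024, Conj. 4 (p. 32)] -/
def avoidConst (q : V → unitInterval) (d : V) (A : Set V) : V → ℝ := fun u =>
  (prodBernoulli q).real ({ω : Set V | ∀ a ∈ A, a ∉ siteCluster Γ ω d} ∩ siteConn Γ d u) /
    (prodBernoulli q).real {ω : Set V | ∀ a ∈ A, a ∉ siteCluster Γ ω d}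

/-- The site decoy/constant list: decoys `d_1, …, d_k` in order, the `j`-th constant conditioned on
`d_j ↮ A ∪ {d_1, …, d_{j-1}}`.  Site twin of `CSH.decoyList`. [cite: KozmaNitzan2024, Conj. 4 (p. 32)] -/
def decoyList (q : V → unitInterval) : Set V → List V → List (V × (V → ℝ))
  | _, [] => []
  | A, d :: ds => (d, avoidConst Γ q d A) :: decoyList q (insert d A) ds

/-- The site observers' constant `p = P(o ↔ v, v ↮ A) / P(v ↮ A)`.  Site twin of `CSH.obsConst`.
[cite: KozmaNitzan2024, Conj. 4 (p. 32)] -/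
def obsConst (q : V → unitInterval) (o v : V) (A : Set V) : ℝ :=
  (prodBernoulli q).real ({ω : Set V | ∀ a ∈ A, a ∉ siteCluster Γ ω v} ∩ siteConn Γ o v) /
    (prodBernoulli q).real {ω : Set V | ∀ a ∈ A, a ∉ siteCluster Γ ω v}

/-- The site denominator-free conditional covariance `covD(f, u) = P(D)·∫_{D ∩ {x↔u}} f(C_x) − (∫_D f(C_x))·P(D ∩ {x↔u})`,
`D = {x ↮ Y} = {∀ y ∈ Y, y ∉ C_x}`, for a functional `f` of the SITE cluster `C_x = siteCluster Γ ω x`.  Site twin of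
`CSH.covD` (there `f` reads the open EDGE cluster). [cite: VandenbergHaggstromKahn2005, Thm. 1.3 (p. 6)] -/
def covD (q : V → unitInterval) (x : V) (Y : Set V) (f : Set V → ℝ) (u : V) : ℝ :=
  (prodBernoulli q).real {ω : Set V | ∀ y ∈ Y, y ∉ siteCluster Γ ω x} *
      (∫ ω in {ω : Set V | ∀ y ∈ Y, y ∉ siteCluster Γ ω x} ∩ siteConn Γ x u,
        f (siteCluster Γ ω x) ∂(prodBernoulli q)) -
    (∫ ω in {ω : Set V | ∀ y ∈ Y, y ∉ siteCluster Γ ω x}, f (siteCluster Γ ω x) ∂(prodBernoulli q)) *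
      (prodBernoulli q).real ({ω : Set V | ∀ y ∈ Y, y ∉ siteCluster Γ ω x} ∩ siteConn Γ x u)

/-- **The margin of site CSH(Y; x; d_1..d_k; o, v)[f]** (level forms of the bond file, site data).
[cite: KozmaNitzan2024, Conj. 4 (p. 32)] -/
def cshMargin (q : V → unitInterval) (x : V) (Y : Set V) (D : List V) (o v : V) (f : Set V → ℝ) : ℝ :=
  cshMarg (decoyList Γ q (insert x Y) D) (obsConst Γ q o v (insert x Y ∪ {d | d ∈ D})) o v (covD Γ q x Y f)

/-- **The SITE conditioned slack hierarchy statement CSH(Y; x; D; o, v)** (OUR conjecture for the site model; the bond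
statement `CSH.CSHHolds` is the tree theorem `CSH.cshHolds`, p205010): the margin is nonnegative for every monotone
functional of the open SITE cluster of the owner.  Census (ttrl T1, 2026-08-20): site CSH level ≤ 1 rows 0 violations,
n ≤ 5 (9.0·10⁷ instances). [cite: VandenbergHaggstromKahn2005, §2.1 (pp. 9–13)] [cite: KozmaNitzan2024, Conj. 4 (p. 32)] -/
def SiteCSHHolds (q : V → unitInterval) (x : V) (Y : Set V) (D : List V) (o v : V) : Prop :=
  ∀ f : Set V → ℝ, Monotone f → 0 ≤ cshMargin Γ q x Y D o v f

/-- **SITE CSH, ALL DATA** (OUR conjecture; the closed statement whose bond twin `CSH.cshAll` is the p205010 theorem):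
for every finite graph, non-degenerate vertex weights, owner `x`, avoided set `Y`, decoy list `D` and observers `o ≠ v`
with the named vertices distinct, `SiteCSHHolds`.  The remaining box of the site finite leg below (S5).
[cite: VandenbergHaggstromKahn2005, §2.1 (pp. 9–13)] [cite: KozmaNitzan2024, Conj. 4 (p. 32)] -/
@[conjecture] def SiteCSHAll : Prop :=
  ∀ (n : ℕ) (Γ : SimpleGraph (Fin n)) (q : Fin n → unitInterval), (∀ v, 0 < q v ∧ q v < 1) →
    ∀ (o v x : Fin n) (Y : Finset (Fin n)) (D : List (Fin n)),
    o ≠ v → x ∉ Y → o ≠ x → v ≠ x → o ∉ Y → v ∉ Y → D.Nodup → (∀ d ∈ D, d ≠ x ∧ d ∉ Y ∧ d ≠ o ∧ d ≠ v) →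
    SiteCSHHolds Γ q x (↑Y : Set (Fin n)) D o v

/-- **The site ranked surplus `Sur_u(T)`** — verbatim the bracket of `SiteGen.SiteSurplusTransfer`:
`∫_{u ↔ T} F(C_u) − Σ_{a ∈ T} P(P^u_a)·m_a`. [cite: KozmaNitzan2024, Conj. 4 (p. 32)] -/
def surplus (q : V → unitInterval) (T : Finset V) (r : V → ℕ) (F : Set V → ℝ) (u : V) : ℝ :=
  (∫ ω in (⋃ a ∈ T, siteConn Γ u a), F (siteCluster Γ ω u) ∂(prodBernoulli q)) -
    ∑ a ∈ T, (prodBernoulli q).real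
        (siteConn Γ u a ∩ ⋂ a' ∈ T.filter (fun a' => r a' < r a), (siteConn Γ u a')ᶜ : Set (Set V)) *
      ∫ ω, F (siteCluster Γ ω a) ∂(prodBernoulli q)

/-- **The margin of site (S5D)[T; d_1..d_k; o, v][F]**: the level form of the relay set applied to `u ↦ Sur_u(T)`.
[cite: KozmaNitzan2024, Conj. 4 (p. 32)] -/
def s5dMargin (q : V → unitInterval) (T : Finset V) (r : V → ℕ) (D : List V) (o v : V) (F : Set V → ℝ) : ℝ :=
  cshMarg (decoyList Γ q ↑T D) (obsConst Γ q o v (↑T ∪ {d | d ∈ D})) o v (surplus Γ q T r F)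

variable {Γ}

/-- With no decoys the site (S5D) margin is `Sur_o(T) − p · Sur_v(T)`, `p = P(o ↔ v, v ↮ T)/P(v ↮ T)`. [folklore] -/
theorem s5dMargin_nil (q : V → unitInterval) (T : Finset V) (r : V → ℕ) (o v : V) (F : Set V → ℝ) :
    s5dMargin Γ q T r [] o v F =
      surplus Γ q T r F o -
        (prodBernoulli q).real ({ω : Set V | ∀ a ∈ (↑T : Set V), a ∉ siteCluster Γ ω v} ∩ siteConn Γ o v) /
            (prodBernoulli q).real {ω : Set V | ∀ a ∈ (↑T : Set V), a ∉ siteCluster Γ ω v} *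
          surplus Γ q T r F v := by
  simp only [s5dMargin, decoyList, cshMarg_nil, obsConst, List.not_mem_nil, setOf_false, union_empty]

/-- **(S5)_site from the decoy-free site (S5D) margin**: if `P(v ↮ T) > 0` and `s5dMargin Γ q T r [] o v F ≥ 0` then
`P(v ↮ T, o ↔ v) · Sur_v(T) ≤ P(v ↮ T) · Sur_o(T)` — exactly the conclusion of `SiteGen.SiteSurplusTransfer` at these data.
[cite: KozmaNitzan2024, Conj. 4 (p. 32)] -/
theorem siteSurplusTransfer_shape_of_s5dMargin_nil (q : V → unitInterval) (T : Finset V) (r : V → ℕ) (o v : V)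
    (F : Set V → ℝ) (hpos : 0 < (prodBernoulli q).real {ω : Set V | ∀ a ∈ (↑T : Set V), a ∉ siteCluster Γ ω v})
    (h : 0 ≤ s5dMargin Γ q T r [] o v F) :
    (prodBernoulli q).real ({ω : Set V | ∀ a ∈ (↑T : Set V), a ∉ siteCluster Γ ω v} ∩ siteConn Γ o v) *
        surplus Γ q T r F v ≤
      (prodBernoulli q).real {ω : Set V | ∀ a ∈ (↑T : Set V), a ∉ siteCluster Γ ω v} * surplus Γ q T r F o := by
  rw [s5dMargin_nil] at h
  set M := (prodBernoulli q).real {ω : Set V | ∀ a ∈ (↑T : Set V), a ∉ siteCluster Γ ω v} with hM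
  set E := (prodBernoulli q).real ({ω : Set V | ∀ a ∈ (↑T : Set V), a ∉ siteCluster Γ ω v} ∩ siteConn Γ o v) with hE
  have h2 : 0 ≤ M * (surplus Γ q T r F o - E / M * surplus Γ q T r F v) := mul_nonneg hpos.le h
  have h3 : M * (surplus Γ q T r F o - E / M * surplus Γ q T r F v) = M * surplus Γ q T r F o - E * surplus Γ q T r F v := by
    field_simp
  linarith [h2, h3]

/-- The site surplus IS the bracket of `SiteGen.SiteSurplusTransfer` (definitional). [folklore] -/
theorem siteSurplusTransfer_iff :
    SiteGen.SiteSurplusTransfer ↔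
      ∀ (n : ℕ) (Γ : SimpleGraph (Fin n)) (q : Fin n → unitInterval) (T : Finset (Fin n)) (o v : Fin n)
        (F : Set (Fin n) → ℝ) (r : Fin n → ℕ),
        v ∉ T → (∀ S S' : Set (Fin n), S ⊆ S' → F S ≤ F S') → (∀ S, 0 ≤ F S) → Set.InjOn r ↑T →
        (∀ a ∈ T, ∀ a' ∈ T, r a < r a' →
          ∫ ω, F (siteCluster Γ ω a) ∂(prodBernoulli q) ≤ ∫ ω, F (siteCluster Γ ω a') ∂(prodBernoulli q)) →
        (prodBernoulli q).real ({ω : Set (Fin n) | ∀ a ∈ T, a ∉ siteCluster Γ ω v} ∩ siteConn Γ o v) *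
            surplus Γ q T r F v ≤
          (prodBernoulli q).real {ω : Set (Fin n) | ∀ a ∈ T, a ∉ siteCluster Γ ω v} * surplus Γ q T r F o :=
  Iff.rfl

end SiteCSH

end Summit.CriticalPhenomena.PercolationContinuityZ3.Theorems.Transplant
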